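import Summits.BirchSwinnertonDyer.BirchSwinnertonDyer.Theorems.KolyvaginRankRigidityAtTwoPhantomCount
import Summits.BirchSwinnertonDyer.BirchSwinnertonDyer.Theorems.ByReductionTypeAtTwoRankOneAtTwoOffBigImageOddLocalEngineRamifiedSupply
import Summits.BirchSwinnertonDyer.BirchSwinnertonDyer.Theorems.KolyvaginRankRigidityAtTwoRegularValueEngineTwoLevel
import Summits.BirchSwinnertonDyer.BirchSwinnertonDyer.Theorems.KolyvaginRankRigidityAtTwoKolyvaginCorankLowerBoundAtTwoThetaGlobalOrderLevelUp
import Literature.NumberTheory.EllipticCurves.HeegnerPointsKolyvaginConjugation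
import Literature.NumberTheory.EllipticCurves.BSDSelmerPConverseSerreProofs
import HarnessLib

/-!
# K1⁺ — `PhantomLineAtTwo` PROVED: the inflation kernel `H¹(K(E[2^(k+1)])/K, E[2^k])` has at most two elements on U1's habitat

Crux U1 `KolyvaginBoundedDefectAtTwo` (stmt-BirchSwinnertonDyer-28083), LINE 17 `regular_core_rigidity`; the pen bsd-idea-1 g13's typed SUPPORT
statement K1⁺ toward the crux stub S2 `CoreRigidityAtTwo` (HOME `line17/PhantomLineAtTwo.lean`, evidence #42; memo `K1_row_memo_g13.md` § v3;
kit rows j327681/j327693/j327729: `|H¹(GL₂(ℤ/2^m), (ℤ/2^j)²)| = 2` for `2 ≤ m ≤ 10`). Width seat `bsd-line-krr2-p2` g17;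
`--supports stmt-BirchSwinnertonDyer-28083 --as helper`. THEOREMS ONLY.

`phantomLineAtTwo` is BYTE-FOR-BYTE the body of the pen's `def PhantomLineAtTwo`, now a theorem for ALL levels `k ≥ 1`: the Galois assembly
of the pure-algebra core `PhantomMatrix.atMostTwo_classes` (files `…PhantomMatrixCocycles`, `…PhantomCongruenceFiltration`, `…PhantomCount`:
steps (1) centre / (2) `S₃`-top / (3) congruence filtration / (4) the one scalar, at cocycle level) with the tree's inputs: a frame
`E[2^(k+1)] ≃ (ℤ/2^(k+1))²` (`nonempty_addEquiv_geomTorsion`), FULL image of `Γ_K` (`Engine.exists_mul_absGaloisRestrict_smul_eq_addAut_of_heegner`,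
`c₀ = 1`, along `RatClosure.torsionEquiv`: this is where odd `d_K` + Heegner enter), the change of level `ι_*` and its injectivity
(`RegularValueEngine.h1Eval_torsionH1OfDvd`, `KolyvaginLowerBoundAtTwo.torsionH1OfDvd_two_pow_injective`), and classes ↔ cocycles
(`reprCocycle`, `oneCocycleClass_eq_zero_iff`). ROLE (pen's card): the ORDER form (one class, uniformly in the level) of the exponent form
`RegularWalk.two_zsmul_eq_zero_of_res_eq_zero` — it bounds by ONE BIT, uniformly in `M`, the torsion error in the freeness-of-rank-one use of
(H.3) in S2's why-it-might-fail. Nothing here proves S2, U1 or BSD. **BSD is NOT proved.**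
[cite: LawsonWuthrich2016, Thm. 1 and §7.1] [cite: Sah1968, Prop. 2.7 (b)] [cite: GrossLMS1991, §9 (before Prop. 9.1)]
-/

set_option autoImplicit false
-- the Theorems namespace of this sub repeats the summit name by design (D-0017 nested layout)
set_option linter.dupNamespace false

noncomputable section

namespace Summit.BirchSwinnertonDyer.BirchSwinnertonDyer.Theorems.KolyvaginAtTwo.PhantomLine

open Matrix
open WeierstrassCurve NumberField Field
open Literature.NumberTheory.GaloisRepresentations Literature.NumberTheory.EllipticCurves Literature.NumberTheory
open Literature.NumberTheory.EllipticCurves.KolyvaginPairing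

/-- Two `2 × 2` matrices with the same action on vectors are equal. [folklore] -/
theorem matrix_eq_of_mulVec_eq {R : Type*} [CommRing R] {A B : Matrix (Fin 2) (Fin 2) R}
    (h : ∀ v : Fin 2 → R, A *ᵥ v = B *ᵥ v) : A = B :=
  Matrix.toLin'.injective (LinearMap.ext fun v ↦ by rw [Matrix.toLin'_apply, Matrix.toLin'_apply, h])

/-- **K1⁺ · PHANTOM LINE AT 2 — PROVED** (the pen's typed support statement `PhantomLineAtTwo`, HOME `line17/PhantomLineAtTwo.lean`,
evidence #42 on stmt-BirchSwinnertonDyer-28083, BYTE-FOR-BYTE the body of the def): on U1's habitat (surjective `ρ̄_{E,2^m}` for all `m`;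
`K` imaginary quadratic with odd discriminant satisfying the Heegner hypothesis for `N_E`) the classes of `H¹(K, E[2^k])` (`k ≥ 1`) that
vanish on `Γ_{K(E[2^(k+1)])}` form a set with AT MOST TWO elements. Proof: in a frame `E[2^(k+1)] ≃ (ℤ/2^(k+1))²`
(`nonempty_addEquiv_geomTorsion`) the Galois action is a multiplicative `ρ : Γ_K → M₂(ℤ/2^(k+1))` whose image contains EVERY invertible
matrix (`OffBigImageOddLocalAtTwo.Engine.exists_mul_absGaloisRestrict_smul_eq_addAut_of_heegner` with `c₀ = 1`, transported along
`RatClosure.torsionEquiv`); the chosen cocycles of `ι_* x`, `ι_* y` (`ι_* = torsionH1OfDvd`, injective on the habitat: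
`KolyvaginLowerBoundAtTwo.torsionH1OfDvd_two_pow_injective`) vanish on `ker ρ` (`RegularValueEngine.h1Eval_torsionH1OfDvd`); so the
pure-algebra core `PhantomMatrix.atMostTwo_classes` (`|H¹(GL₂(ℤ/2^m), (ℤ/2^m)²)| ≤ 2` at cocycle level, all `m ≥ 2`) applies, and a
coboundary means the class is `0` (`oneCocycleClass_eq_zero_iff`). The ORDER form of Sah's exponent form
`RegularWalk.two_zsmul_eq_zero_of_res_eq_zero`. [cite: LawsonWuthrich2016, Thm. 1 and §7.1] [cite: Sah1968, Prop. 2.7 (b)]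
[cite: GrossLMS1991, §9 (before Prop. 9.1)] -/
theorem phantomLineAtTwo :
    ∀ (W : WeierstrassCurve ℚ) [W.IsElliptic], (∀ m : ℕ, W.HasSurjectiveModNGaloisRep (2 ^ m : ℕ)) →
    ∀ (K : Type) [Field K] [NumberField K], IsImaginaryQuadratic K → Odd (NumberField.discr K) →
      ∀ [NeZero (W.conductorNorm ℤ)], SatisfiesHeegnerHypothesis (W.conductorNorm ℤ) K →
        ∀ (k : ℕ), 1 ≤ k → ∀ (x y : galH1Torsion (W.baseChange K) ((2 ^ k : ℕ) : ℤ)),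
          (∀ ρ ∈ torsionFixing (W.baseChange K) ((2 ^ (k + 1) : ℕ) : ℤ), h1Eval (W.baseChange K) ((2 ^ k : ℕ) : ℤ) x ρ = 0) →
          (∀ ρ ∈ torsionFixing (W.baseChange K) ((2 ^ (k + 1) : ℕ) : ℤ), h1Eval (W.baseChange K) ((2 ^ k : ℕ) : ℤ) y ρ = 0) →
            x = 0 ∨ y = 0 ∨ x = y := by
  intro W _ hsurj K _ _ hK hodd _ hH k hk x y hx hy
  classical
  haveI : (W.baseChange K).IsElliptic := inferInstanceAs ((W.map (algebraMap ℚ K)).IsElliptic)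
  haveI : Fact (Nat.Prime 2) := ⟨Nat.prime_two⟩
  have hdvd : ((2 ^ k : ℕ) : ℤ) ∣ ((2 ^ (k + 1) : ℕ) : ℤ) := by exact_mod_cast pow_dvd_pow 2 (Nat.le_succ k)
  -- the frame
  obtain ⟨e⟩ := nonempty_addEquiv_geomTorsion (W.baseChange K) 2 (k + 1) (by omega) (by norm_num)
  -- the matrix of the action
  let act : absoluteGaloisGroup K → (Fin 2 → ZMod (2 ^ (k + 1))) →+ (Fin 2 → ZMod (2 ^ (k + 1))) :=
    fun γ ↦ e.toAddMonoidHom.comp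
      ((DistribSMul.toAddMonoidHom (geomTorsion (W.baseChange K) ((2 ^ (k + 1) : ℕ) : ℤ)) γ).comp e.symm.toAddMonoidHom)
  let ρM : absoluteGaloisGroup K → Matrix (Fin 2) (Fin 2) (ZMod (2 ^ (k + 1))) :=
    fun γ ↦ LinearMap.toMatrix' ((act γ).toZModLinearMap (2 ^ (k + 1)))
  have hρv : ∀ (γ : absoluteGaloisGroup K) (t : geomTorsion (W.baseChange K) ((2 ^ (k + 1) : ℕ) : ℤ)),
      e (γ • t) = ρM γ *ᵥ e t := by
    intro γ t
    rw [← Matrix.toLin'_apply, Matrix.toLin'_toMatrix']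
    show e (γ • t) = e (γ • e.symm (e t))
    rw [e.symm_apply_apply]
  have hρv' : ∀ (γ : absoluteGaloisGroup K) (v : Fin 2 → ZMod (2 ^ (k + 1))), ρM γ *ᵥ v = e (γ • e.symm v) := by
    intro γ v; rw [hρv, e.apply_symm_apply]
  have hρ : ∀ g h, ρM (g * h) = ρM g * ρM h := fun g h ↦
    matrix_eq_of_mulVec_eq fun v ↦ by rw [← mulVec_mulVec, hρv' h v, ← hρv g, hρv' (g * h) v, mul_smul]
  have hρ1 : ρM 1 = 1 := matrix_eq_of_mulVec_eq fun v ↦ by rw [hρv', one_smul, e.apply_symm_apply, one_mulVec]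
  -- every invertible matrix is realised by `Γ_K`
  have hsurjM : ∀ M : Matrix (Fin 2) (Fin 2) (ZMod (2 ^ (k + 1))), IsUnit M → ∃ γ, ρM γ = M := by
    rintro M ⟨u, rfl⟩
    let Me : (Fin 2 → ZMod (2 ^ (k + 1))) ≃+ (Fin 2 → ZMod (2 ^ (k + 1))) :=
      { toFun := fun v ↦ (u : Matrix (Fin 2) (Fin 2) (ZMod (2 ^ (k + 1)))) *ᵥ v
        invFun := fun v ↦ (↑u⁻¹ : Matrix (Fin 2) (Fin 2) (ZMod (2 ^ (k + 1)))) *ᵥ v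
        left_inv := fun v ↦ by simp only [mulVec_mulVec, Units.inv_mul, one_mulVec]
        right_inv := fun v ↦ by simp only [mulVec_mulVec, Units.mul_inv, one_mulVec]
        map_add' := fun v w ↦ mulVec_add _ _ _ }
    have hMe : ∀ v, Me v = (u : Matrix (Fin 2) (Fin 2) (ZMod (2 ^ (k + 1)))) *ᵥ v := fun v ↦ rfl
    let A : geomTorsion (W.baseChange K) ((2 ^ (k + 1) : ℕ) : ℤ) ≃+ geomTorsion (W.baseChange K) ((2 ^ (k + 1) : ℕ) : ℤ) :=
      e.trans (Me.trans e.symm)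
    have hA : ∀ Q, A Q = e.symm (Me (e Q)) := fun Q ↦ rfl
    set θ := RatClosure.torsionEquiv (K := K) W ((2 ^ (k + 1) : ℕ) : ℤ) with hθ
    let A' : geomTorsion W ((2 ^ (k + 1) : ℕ) : ℤ) ≃+ geomTorsion W ((2 ^ (k + 1) : ℕ) : ℤ) := θ.trans (A.trans θ.symm)
    have hA' : ∀ P, A' P = θ.symm (A (θ P)) := fun P ↦ rfl
    obtain ⟨γ, hγ⟩ := OffBigImageOddLocalAtTwo.Engine.exists_mul_absGaloisRestrict_smul_eq_addAut_of_heegner hK hodd hH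
      (hsurj (k + 1)) 1 A'
    have key : ∀ Q : geomTorsion (W.baseChange K) ((2 ^ (k + 1) : ℕ) : ℤ), γ • Q = A Q := by
      intro Q
      have h1 := hγ (θ.symm Q)
      rw [one_mul] at h1
      have h2 := RatClosure.torsionEquiv_smul W ((2 ^ (k + 1) : ℕ) : ℤ) γ (θ.symm Q)
      rw [← hθ, θ.apply_symm_apply, h1, hA', θ.apply_symm_apply, θ.apply_symm_apply] at h2
      exact h2.symm
    refine ⟨γ, matrix_eq_of_mulVec_eq fun v ↦ ?_⟩
    rw [hρv', key, hA, e.apply_symm_apply, e.apply_symm_apply, hMe]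
  -- the chosen cocycles of `ι_* x`, `ι_* y` in the frame are matrix cocycles vanishing on `ker ρM`
  have cocy : ∀ φ : contOneCocycles (discreteTopRep (absoluteGaloisGroup K) (geomTorsion (W.baseChange K) ((2 ^ (k + 1) : ℕ) : ℤ))),
      ∀ g h, e (φ.1 (g * h)) = e (φ.1 g) + ρM g *ᵥ e (φ.1 h) := by
    intro φ g h
    have := φ.2 g h
    rw [discreteTopRep_ρ_apply] at this
    rw [this, map_add, hρv]
  have hker : ∀ γ : absoluteGaloisGroup K, ρM γ = 1 → γ ∈ torsionFixing (W.baseChange K) ((2 ^ (k + 1) : ℕ) : ℤ) := by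
    intro γ h1
    rw [mem_torsionFixing_iff]
    intro P
    apply e.injective
    rw [hρv, h1, one_mulVec]
  have van : ∀ (z : galH1Torsion (W.baseChange K) ((2 ^ k : ℕ) : ℤ)),
      (∀ ρ ∈ torsionFixing (W.baseChange K) ((2 ^ (k + 1) : ℕ) : ℤ), h1Eval (W.baseChange K) ((2 ^ k : ℕ) : ℤ) z ρ = 0) →
      ∀ γ : absoluteGaloisGroup K, ρM γ = 1 →
        e ((reprCocycle (W.baseChange K) ((2 ^ (k + 1) : ℕ) : ℤ) (torsionH1OfDvd (W.baseChange K) hdvd z)).1 γ) = 0 := by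
    intro z hz γ h1
    have h := RegularValueEngine.h1Eval_torsionH1OfDvd (W.baseChange K) hdvd z (hker γ h1)
    rw [hz γ (hker γ h1), map_zero] at h
    show e (h1Eval (W.baseChange K) _ (torsionH1OfDvd (W.baseChange K) hdvd z) γ) = 0
    rw [h, map_zero]
  -- the count
  have core := PhantomMatrix.atMostTwo_classes (m := k + 1) (by omega) hρ hρ1 hsurjM
    (ψ₁ := fun γ ↦ e ((reprCocycle (W.baseChange K) ((2 ^ (k + 1) : ℕ) : ℤ) (torsionH1OfDvd (W.baseChange K) hdvd x)).1 γ))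
    (ψ₂ := fun γ ↦ e ((reprCocycle (W.baseChange K) ((2 ^ (k + 1) : ℕ) : ℤ) (torsionH1OfDvd (W.baseChange K) hdvd y)).1 γ))
    (cocy _) (cocy _) (van x hx) (van y hy)
  -- back to classes
  have hinj := KolyvaginLowerBoundAtTwo.torsionH1OfDvd_two_pow_injective W (K := K) hK.1 (by simpa using hsurj 1) hdvd
  have zero_of : ∀ (z : galH1Torsion (W.baseChange K) ((2 ^ k : ℕ) : ℤ)) (w : Fin 2 → ZMod (2 ^ (k + 1))),
      (∀ g, e ((reprCocycle (W.baseChange K) ((2 ^ (k + 1) : ℕ) : ℤ) (torsionH1OfDvd (W.baseChange K) hdvd z)).1 g) =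
        ρM g *ᵥ w - w) → z = 0 := by
    intro z w hw
    apply hinj
    rw [map_zero, ← oneCocycleClass_reprCocycle (W.baseChange K) _ (torsionH1OfDvd (W.baseChange K) hdvd z),
      oneCocycleClass_eq_zero_iff]
    refine ⟨e.symm w, fun g ↦ e.injective ?_⟩
    rw [discreteTopRep_ρ_apply, hw g, map_sub, hρv, e.apply_symm_apply]
  rcases core with ⟨w, hw⟩ | ⟨w, hw⟩ | ⟨w, hw⟩
  · exact Or.inl (zero_of x w hw)
  · exact Or.inr (Or.inl (zero_of y w hw))
  · right; right
    apply hinj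
    rw [← sub_eq_zero, ← oneCocycleClass_reprCocycle (W.baseChange K) _ (torsionH1OfDvd (W.baseChange K) hdvd x),
      ← oneCocycleClass_reprCocycle (W.baseChange K) _ (torsionH1OfDvd (W.baseChange K) hdvd y)]
    have hsub := map_sub (oneCocycleClassₗ (discreteTopRep (absoluteGaloisGroup K)
      (geomTorsion (W.baseChange K) ((2 ^ (k + 1) : ℕ) : ℤ))))
      (reprCocycle (W.baseChange K) ((2 ^ (k + 1) : ℕ) : ℤ) (torsionH1OfDvd (W.baseChange K) hdvd x))
      (reprCocycle (W.baseChange K) ((2 ^ (k + 1) : ℕ) : ℤ) (torsionH1OfDvd (W.baseChange K) hdvd y))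
    change oneCocycleClass _ (_ - _) = oneCocycleClass _ _ - oneCocycleClass _ _ at hsub
    rw [← hsub, oneCocycleClass_eq_zero_iff]
    refine ⟨e.symm w, fun g ↦ e.injective ?_⟩
    have e1 : ((reprCocycle (W.baseChange K) ((2 ^ (k + 1) : ℕ) : ℤ) (torsionH1OfDvd (W.baseChange K) hdvd x)) -
        (reprCocycle (W.baseChange K) ((2 ^ (k + 1) : ℕ) : ℤ) (torsionH1OfDvd (W.baseChange K) hdvd y))).1 g =
        (reprCocycle (W.baseChange K) ((2 ^ (k + 1) : ℕ) : ℤ) (torsionH1OfDvd (W.baseChange K) hdvd x)).1 g -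
        (reprCocycle (W.baseChange K) ((2 ^ (k + 1) : ℕ) : ℤ) (torsionH1OfDvd (W.baseChange K) hdvd y)).1 g := rfl
    have hw' := hw g
    simp only at hw'
    rw [discreteTopRep_ρ_apply, e1, map_sub, hw', map_sub, hρv, e.apply_symm_apply]

end Summit.BirchSwinnertonDyer.BirchSwinnertonDyer.Theorems.KolyvaginAtTwo.PhantomLine

end
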